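import Literature.AlgebraicGeometry.HodgeTheory.WeilTypePeriodPoint
import Literature.AlgebraicGeometry.HodgeTheory.RationalClassesRingChange
import Literature.AlgebraicGeometry.HodgeTheory.HodgeStructureOfHodgeModel
import Literature.AlgebraicGeometry.HodgeTheory.AbelJacobiPullbackHodgeSection
import Literature.AlgebraicGeometry.Motives.PeriodRealizationClassical
import Literature.AlgebraicGeometry.Motives.WeilDatumPeriodDomain
import HarnessLib

/-!
# The rational Weil datum `(H¹(A(ℂ); ℚ), φ^*, E)` of an abelian variety of Weil type

Family `hodge`, layer `Literature/AlgebraicGeometry/HodgeTheory`; definitions with bodies and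
theorems, no named fact (D-0026). Van Geemen (LNM 1594, 5.3): "a polarized abelian variety of
Weil-type of dimension `2n` `(X, K, E)` provides such data" `(V, K, H, Λ)` — `V = H¹(X, ℚ)`
(van Geemen 4.8: `K = End`-action "using the maps `f^*`"), `E` the Riemann form of the polarization
(4.9: alternating, `(√-d)^* E = d E`), `H = E(x, (√-d) y) + √-d E(x, y)` (Lemma 5.2 (2):
non-degenerate Hermitian); Deligne (LNM 900, proof of Thm. 4.8, pp. 47–48): `H = H₁(A, ℚ)`,
`ψ = Tr(f φ)` split, and the family `Γ\B → Γ\X⁺` built from `(H, ψ)`. The tree has the ABSTRACT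
datum as `Motives.WeilDatum V` (`Motives/WeilDatumPeriodDomain`: `d > 0`, `α` with `α² = -d`, `E`
alternating non-degenerate with `E(αx, αy) = d E(x, y)`), with the period domain
`{J | IsWeilComplexStructure D.hForm J} ≃ unitaryPeriodDomain n n` in the hyperbolic case
(`WeilDatum.nonempty_weilComplexStructureEquiv_of_isotropic`) and the fibre Hodge structures
(`Motives/WeilDatumHodgeStructure`). THIS file CONSTRUCTS the datum of an ACTUAL abelian variety of
Weil type on the tree's carriers and proves its hypotheses:

* `ratPolarizationForm h hh j ℓ hℓ` — for a rational `h ∈ H²(X(ℂ); ℂ)`, an exponent `j` and a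
  functional `ℓ` on `H^{2+2j}(X(ℂ); ℂ)` RATIONAL on rational classes (e.g. the coordinate
  `lineCoord ω₀` along a rational generator of the top line), the `ℚ`-VALUED bilinear form
  `E(x, y) = ℓ(Q_h(x ⊗ 1, y ⊗ 1))` on the rational Betti cohomology
  `Motives.bettiCohomology X 1 = H¹(X(ℂ); ℚ)` (`ratPolarizationForm_spec`); alternating
  (`ratPolarizationForm_swap`); it is the tree's `realPolarizationForm` on the rational lattice
  (`ratPolarizationForm_eq_realPolarizationForm`);
* for `(A, φ, e, a)`, `φ ≫ φ = -d`, `h_K = d·e^*a + φ^*e^*a`, `α = φ^*_ℚ`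
  (`Motives.bettiCohomology.map φ 1`): `α² = -d` (`bettiMap_bettiMap_of_comp_self`),
  `E(αx, αy) = d E(x, y)` (`ratPolarizationForm_map_map_ksymm`), and for `dim A = m + 1 ≥ 2`
  NON-DEGENERACY (`nondegenerate_ratPolarizationForm_ksymm`, from the positivity of the period
  point, `exists_pos_polarizationPairingOne_weilOperatorOne`: `Q_{h_K}(x, Cx) ≠ 0` for a real
  `x ≠ 0`, and rational classes span `H¹(A(ℂ); ℂ)`);
* `weilDatumOfKsymm … : Motives.WeilDatum (Motives.bettiCohomology A.X 1)` — **the Weil datum of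
  `(A, φ, h_K)`** (van Geemen 5.3 "provides such data"), with `dim_ℚ = 2 dim A`
  (`finrank_bettiCohomology_one`);
* `exists_isotropic_submodule_of_isHyperbolicWeilType` — **hyperbolic ⟹ the datum is split**:
  `Motives.IsHyperbolicWeilType A φ n h_K` (a rational `φ^*`-stable `Q_{h_K}`-Lagrangian `2n`-frame
  of `H¹(A(ℂ); ℂ)`) yields an `α`-stable `ℚ`-subspace `W ⊆ H¹(A(ℂ); ℚ)` of dimension `2n` on which
  `E` vanishes (Deligne–Milne Cor. 4.2 (b); van Geemen 5.2: Witt index `n`);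
* hence `nonempty_weilComplexStructureEquiv_of_isHyperbolicWeilType` — **the period domain of a
  hyperbolic abelian `2n`-fold of Weil type is the bounded symmetric domain of `U(n, n)`**:
  `{J | IsWeilComplexStructure D.hForm J} ≃ unitaryPeriodDomain n n` for its datum `D` (the other
  seat's `WeilDatum.nonempty_weilComplexStructureEquiv_of_isotropic`, fed with this file).

With `Motives/WeilHermitianWitt.exists_linearEquiv_weil_of_isotropic_rat` the data of two
hyperbolic `(A, φ, h_A)`, `(P, ψ₀, h_P)` of the same dimension are `K`-linearly isometric
(Deligne p. 50 (b), first half); not here.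

## References

* [vanGeemen1994HodgeAV] B. van Geemen, An introduction to the Hodge conjecture for abelian
  varieties, LNM 1594 (1994), 4.8–4.9, Lemma 5.2 (1)–(2), 5.3.
* [Deligne1982HodgeCycles] P. Deligne (notes by J. S. Milne), Hodge cycles on abelian varieties,
  LNM 900 (1982), §4 Cor. 4.2, proof of Thm. 4.8 (pp. 47–50).
* [LangeBirkenhake1992] H. Lange, Ch. Birkenhake, Complex Abelian Varieties (1992), Lemma 1.1.17,
  Thm. 4.2.1.
* [HatcherAT2002] A. Hatcher, Algebraic Topology (2002), §3.1 Thm. 3.2 and p. 198.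
-/

noncomputable section

open CategoryTheory AlgebraicGeometry
open Literature.AlgebraicTopology.SingularHomology
open Literature.AlgebraicGeometry.Motives (projectiveSpace ComplexPoints IsSmoothProjective
  polarizationPairingOne AbelianVariety ProjectiveEmbedding bettiCohomology)

namespace Literature.AlgebraicGeometry.HodgeTheory

section HodgeTheory

/-! ### The `ℚ`-valued polarization form on `H¹(X(ℂ); ℚ)` -/

section RatForm

variable {X : Motives.SchemeOver ℂ}

/-- `Q_h(x ⊗ 1, y ⊗ 1)` is a rational class for rational `h` and `x, y ∈ H¹(X(ℂ); ℚ)`.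
[cite: HatcherAT2002, §3.1 Thm. 3.2 and p. 198] -/
theorem isRationalClass_polarizationPairingOne_ofRatClass {h : complexBetti X 2} (hh : IsRationalClass h) (j : ℕ)
    (x y : bettiCohomology X 1) :
    IsRationalClass (polarizationPairingOne X h j (ofRatClass (ComplexPoints X) 1 x) (ofRatClass (ComplexPoints X) 1 y)) :=
  Motives.isRationalClass_polarizationPairingOne hh j (isRationalClass_ofRatClass x) (isRationalClass_ofRatClass y)

/-- The value `E(x, y) ∈ ℚ` with `(E(x, y) : ℂ) = ℓ(Q_h(x ⊗ 1, y ⊗ 1))` (extracted by choice from the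
rationality of `ℓ` on rational classes; the function underlying `ratPolarizationForm`).
[cite: vanGeemen1994HodgeAV, 4.8–4.9] -/
def ratPolarizationFormFun (h : complexBetti X 2) (hh : IsRationalClass h) (j : ℕ)
    (ℓ : complexBetti X (2 + 2 * j) →ₗ[ℂ] ℂ)
    (hℓ : ∀ c : complexBetti X (2 + 2 * j), IsRationalClass c → ∃ q : ℚ, ℓ c = q)
    (x y : bettiCohomology X 1) : ℚ :=
  (hℓ _ (isRationalClass_polarizationPairingOne_ofRatClass hh j x y)).choose

/-- `(E(x, y) : ℂ) = ℓ(Q_h(x ⊗ 1, y ⊗ 1))` for the underlying function. [cite: vanGeemen1994HodgeAV, 4.8–4.9] -/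
theorem ratPolarizationFormFun_spec (h : complexBetti X 2) (hh : IsRationalClass h) (j : ℕ)
    (ℓ : complexBetti X (2 + 2 * j) →ₗ[ℂ] ℂ)
    (hℓ : ∀ c : complexBetti X (2 + 2 * j), IsRationalClass c → ∃ q : ℚ, ℓ c = q)
    (x y : bettiCohomology X 1) :
    ((ratPolarizationFormFun h hh j ℓ hℓ x y : ℚ) : ℂ) =
      ℓ (polarizationPairingOne X h j (ofRatClass (ComplexPoints X) 1 x) (ofRatClass (ComplexPoints X) 1 y)) :=
  ((hℓ _ (isRationalClass_polarizationPairingOne_ofRatClass hh j x y)).choose_spec).symm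

/-- **The rational polarization form** `E(x, y) = ℓ(Q_h(x ⊗ 1, y ⊗ 1)) ∈ ℚ` on
`H¹(X(ℂ); ℚ) = Motives.bettiCohomology X 1`, for a rational class `h ∈ H²(X(ℂ); ℂ)`, an exponent
`j` and a linear functional `ℓ` on `H^{2+2j}(X(ℂ); ℂ)` taking rational values on rational classes
(`Q_h` of rational classes is rational, `Motives.isRationalClass_polarizationPairingOne`; the value
is pinned by `ratPolarizationForm_spec`). For `X = A` abelian, `h` a polarization class and `ℓ` the
coordinate along a rational generator of `H^{2 dim A}`, this is the Riemann form `E` on `H¹(A, ℚ)`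
up to `ℚ^×` (van Geemen 4.8–4.9; Birkenhake–Lange 1.1.17, 4.2.1).
[cite: vanGeemen1994HodgeAV, 4.8–4.9] [cite: LangeBirkenhake1992, Lemma 1.1.17 and Thm. 4.2.1] -/
def ratPolarizationForm (h : complexBetti X 2) (hh : IsRationalClass h) (j : ℕ)
    (ℓ : complexBetti X (2 + 2 * j) →ₗ[ℂ] ℂ)
    (hℓ : ∀ c : complexBetti X (2 + 2 * j), IsRationalClass c → ∃ q : ℚ, ℓ c = q) :
    LinearMap.BilinForm ℚ (bettiCohomology X 1) :=
  LinearMap.mk₂ ℚ (ratPolarizationFormFun h hh j ℓ hℓ)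
    (fun x x' y ↦ by
      apply Rat.cast_injective (α := ℂ)
      rw [Rat.cast_add, ratPolarizationFormFun_spec, ratPolarizationFormFun_spec, ratPolarizationFormFun_spec,
        map_add, map_add, LinearMap.add_apply, map_add])
    (fun q x y ↦ by
      apply Rat.cast_injective (α := ℂ)
      rw [smul_eq_mul, Rat.cast_mul, ratPolarizationFormFun_spec, ratPolarizationFormFun_spec,
        Motives.ofRatClass_smul, map_smul, LinearMap.smul_apply, map_smul, smul_eq_mul])
    (fun x y y' ↦ by
      apply Rat.cast_injective (α := ℂ)
      rw [Rat.cast_add, ratPolarizationFormFun_spec, ratPolarizationFormFun_spec, ratPolarizationFormFun_spec,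
        map_add, map_add, map_add])
    (fun q x y ↦ by
      apply Rat.cast_injective (α := ℂ)
      rw [smul_eq_mul, Rat.cast_mul, ratPolarizationFormFun_spec, ratPolarizationFormFun_spec,
        Motives.ofRatClass_smul, map_smul, map_smul, smul_eq_mul])

/-- **The defining identity**: `(E(x, y) : ℂ) = ℓ(Q_h(x ⊗ 1, y ⊗ 1))`. [cite: vanGeemen1994HodgeAV, 4.8–4.9] -/
theorem ratPolarizationForm_spec (h : complexBetti X 2) (hh : IsRationalClass h) (j : ℕ)
    (ℓ : complexBetti X (2 + 2 * j) →ₗ[ℂ] ℂ)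
    (hℓ : ∀ c : complexBetti X (2 + 2 * j), IsRationalClass c → ∃ q : ℚ, ℓ c = q)
    (x y : bettiCohomology X 1) :
    ((ratPolarizationForm h hh j ℓ hℓ x y : ℚ) : ℂ) =
      ℓ (polarizationPairingOne X h j (ofRatClass (ComplexPoints X) 1 x) (ofRatClass (ComplexPoints X) 1 y)) :=
  ratPolarizationFormFun_spec h hh j ℓ hℓ x y

/-- **`E` is alternating**: `E(y, x) = -E(x, y)`. [cite: vanGeemen1994HodgeAV, 4.9] [cite: HatcherAT2002, Thm. 3.11] -/
theorem ratPolarizationForm_swap (h : complexBetti X 2) (hh : IsRationalClass h) (j : ℕ)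
    (ℓ : complexBetti X (2 + 2 * j) →ₗ[ℂ] ℂ)
    (hℓ : ∀ c : complexBetti X (2 + 2 * j), IsRationalClass c → ∃ q : ℚ, ℓ c = q)
    (x y : bettiCohomology X 1) :
    ratPolarizationForm h hh j ℓ hℓ y x = -ratPolarizationForm h hh j ℓ hℓ x y := by
  apply Rat.cast_injective (α := ℂ)
  rw [Rat.cast_neg, ratPolarizationForm_spec, ratPolarizationForm_spec, polarizationPairingOne_swap, map_neg]

/-- `E(x, x) = 0`. [cite: HatcherAT2002, Thm. 3.11] -/
theorem ratPolarizationForm_self (h : complexBetti X 2) (hh : IsRationalClass h) (j : ℕ)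
    (ℓ : complexBetti X (2 + 2 * j) →ₗ[ℂ] ℂ)
    (hℓ : ∀ c : complexBetti X (2 + 2 * j), IsRationalClass c → ∃ q : ℚ, ℓ c = q)
    (x : bettiCohomology X 1) : ratPolarizationForm h hh j ℓ hℓ x x = 0 := by
  have h2 := ratPolarizationForm_swap h hh j ℓ hℓ x x
  linarith

/-- `E` is reflexive (being alternating). [folklore] -/
theorem isRefl_ratPolarizationForm (h : complexBetti X 2) (hh : IsRationalClass h) (j : ℕ)
    (ℓ : complexBetti X (2 + 2 * j) →ₗ[ℂ] ℂ)
    (hℓ : ∀ c : complexBetti X (2 + 2 * j), IsRationalClass c → ∃ q : ℚ, ℓ c = q) :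
    (ratPolarizationForm h hh j ℓ hℓ).IsRefl := fun x y hxy ↦ by
  rw [ratPolarizationForm_swap, hxy, neg_zero]

/-- The change of coefficients `H¹(X(ℂ); ℚ) → H¹(X(ℂ); ℝ)`, `a ↦ a ⊗_ℚ ℝ` (the tree's `coeffClass`
along `ℚ → ℝ`; `ofRatClass = ofRealClass ∘ toRealOne`, `ofRatClass_eq_ofRealClass_coeffClass`).
[cite: HatcherAT2002, §3.1 p. 198] -/
def toRealOne (X : Motives.SchemeOver ℂ) :
    bettiCohomology X 1 →+ singularCohomology ℝ ℝ (ComplexPoints X) 1 :=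
  coeffClass (R := ℚ) (S := ℝ) (Rat.castHom ℝ).toAddMonoidHom 1

/-- `(a ⊗_ℚ ℝ) ⊗_ℝ ℂ = a ⊗_ℚ ℂ`. [folklore] -/
theorem ofRealClass_toRealOne (a : bettiCohomology X 1) :
    ofRealClass (ComplexPoints X) 1 (toRealOne X a) = ofRatClass (ComplexPoints X) 1 a :=
  (ofRatClass_eq_ofRealClass_coeffClass a).symm

/-- **On the rational lattice the real Riemann form is the rational one**:
`ψ_ℓ(a ⊗ ℝ, b ⊗ ℝ) = E(a, b)` (`realPolarizationForm` of `WeilTypePeriodPoint` vs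
`ratPolarizationForm`). [cite: vanGeemen1994HodgeAV, 4.8–4.9] -/
theorem ratPolarizationForm_eq_realPolarizationForm (h : complexBetti X 2) (hh : IsRationalClass h) (j : ℕ)
    (ℓ : complexBetti X (2 + 2 * j) →ₗ[ℂ] ℂ)
    (hℓ : ∀ c : complexBetti X (2 + 2 * j), IsRationalClass c → ∃ q : ℚ, ℓ c = q)
    (x y : bettiCohomology X 1) :
    (ratPolarizationForm h hh j ℓ hℓ x y : ℝ) = realPolarizationForm h j ℓ (toRealOne X x) (toRealOne X y) := by
  rw [realPolarizationForm_apply, ofRealClass_toRealOne, ofRealClass_toRealOne, ← ratPolarizationForm_spec,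
    Complex.ratCast_re]

/-- The coordinate `lineCoord ω₀` along a rational generator is rational on rational classes (the
admissible `ℓ`; `exists_lineCoord_eq_ratCast` of `WeilTypePeriodPoint`). [cite: HatcherAT2002, §3.1 Thm. 3.2 and p. 198] -/
theorem lineCoord_ratValued {k : ℕ} (h1 : Module.finrank ℂ (complexBetti X k) = 1) {ω₀ : complexBetti X k}
    (hω : IsRationalClass ω₀) (hω0 : ω₀ ≠ 0) :
    ∀ c : complexBetti X k, IsRationalClass c → ∃ q : ℚ, lineCoord ω₀ hω0 h1 c = q :=
  fun _ hc ↦ exists_lineCoord_eq_ratCast h1 hω hω0 hc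

/-! ### The rational pull-back `φ^*_ℚ` -/

/-- `(g^*_ℚ a) ⊗ 1 = g^* (a ⊗ 1)` for the Betti pull-back `Motives.bettiCohomology.map g 1`.
[cite: HatcherAT2002, §3.1 p. 198] -/
theorem ofRatClass_bettiMap (g : X ⟶ X) (a : bettiCohomology X 1) :
    ofRatClass (ComplexPoints X) 1 (bettiCohomology.map g 1 a) = complexBetti.map g 1 (ofRatClass (ComplexPoints X) 1 a) :=
  Motives.ofRatClass_map _ _ a

/-- **`(φ^*_ℚ)² = -d` on `H¹(A(ℂ); ℚ)`** for `φ ≫ φ = -d` (the tree's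
`complexBetti_map_map_one_of_comp_self`, descended along the injective `H¹(ℚ) → H¹(ℂ)`).
[cite: LangeBirkenhake1992, Prop. 1.1.9 and Lemma 1.1.17] [cite: vanGeemen1994HodgeAV, Lemma 5.2] -/
theorem bettiMap_bettiMap_of_comp_self {A : AbelianVariety ℂ} {d : ℕ} {φ : A ⟶ A}
    (hφ : φ ≫ φ = -(d • 𝟙 A)) (a : bettiCohomology A.X 1) :
    bettiCohomology.map φ.hom.hom.hom 1 (bettiCohomology.map φ.hom.hom.hom 1 a) = -((d : ℚ) • a) := by
  apply ofRatClass_injective (Y := ComplexPoints A.X) 1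
  rw [ofRatClass_bettiMap, ofRatClass_bettiMap, map_neg, Motives.ofRatClass_smul, Rat.cast_natCast]
  exact complexBetti_map_map_one_of_comp_self hφ _

end RatForm

/-! ### The datum of `(A, φ, h_K)` -/

section Datum

variable {m d : ℕ} {A : AbelianVariety ℂ}

/-- **`E(φ^*x, φ^*y) = d · E(x, y)`** for the rational Riemann form of `h_K = d·e^*a + φ^*e^*a`,
`φ ≫ φ = -d` (van Geemen 4.9: `(√-d)^* E = d E`; the tree's `polarizationPairingOne_map_map_ksymm`
read on the rational lattice). [cite: vanGeemen1994HodgeAV, 4.9 and Lemma 5.2 (2)] -/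
theorem ratPolarizationForm_map_map_ksymm (hA : A.dim = m + 1) (hd : 0 < d) {φ : A ⟶ A}
    (hφ : φ ≫ φ = -(d • 𝟙 A)) (e : ProjectiveEmbedding A.X) {a : complexBetti (projectiveSpace e.n ℂ) 2}
    (ha : IsRationalClass a) (ℓ : complexBetti A.X (2 + 2 * m) →ₗ[ℂ] ℂ)
    (hℓ : ∀ c : complexBetti A.X (2 + 2 * m), IsRationalClass c → ∃ q : ℚ, ℓ c = q)
    (x y : bettiCohomology A.X 1) :
    ratPolarizationForm _ (isRationalClass_ksymm d φ e ha) m ℓ hℓ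
        (bettiCohomology.map φ.hom.hom.hom 1 x) (bettiCohomology.map φ.hom.hom.hom 1 y) =
      d * ratPolarizationForm _ (isRationalClass_ksymm d φ e ha) m ℓ hℓ x y := by
  apply Rat.cast_injective (α := ℂ)
  rw [Rat.cast_mul, Rat.cast_natCast, ratPolarizationForm_spec, ratPolarizationForm_spec, ofRatClass_bettiMap,
    ofRatClass_bettiMap, polarizationPairingOne_map_map_ksymm hA hd hφ e a, map_smul, smul_eq_mul]

/-- **Non-degeneracy of the rational Riemann form** of `(A, φ, h_K)`, `dim A = m + 1 ≥ 2`, with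
`ℓ = lineCoord ω₀` the coordinate along a rational generator `ω₀` of `H^{2m+2}(A(ℂ); ℂ)`: if
`E(x, y) = 0` for all rational `y` then `ℓ(Q_{h_K}(x ⊗ 1, c)) = 0` for all `c ∈ H¹(A(ℂ); ℂ)` (rational
classes span), hence `Q_{h_K}(x ⊗ 1, ·) = 0` (`ℓ` is injective on the line), contradicting the
positivity `Q_{h_K}(x ⊗ 1, C(x ⊗ 1)) = t ω₀'`, `t > 0`, of the period point for `x ≠ 0`
(`exists_pos_polarizationPairingOne_weilOperatorOne`). Van Geemen Lemma 5.2 (2): "`H` is a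
non-degenerate Hermitian form" — on `H¹` the Riemann form itself is non-degenerate.
[cite: vanGeemen1994HodgeAV, Lemma 5.2 (2)] [cite: LangeBirkenhake1992, Thm. 4.2.1] -/
theorem nondegenerate_ratPolarizationForm_ksymm (hm : 1 ≤ m) (hA : A.dim = m + 1) (hd : 0 < d) (φ : A ⟶ A)
    (e : ProjectiveEmbedding A.X) {a : complexBetti (projectiveSpace e.n ℂ) 2} (ha : IsRationalClass a)
    (ha0 : a ≠ 0) {ω₀ : complexBetti A.X (2 + 2 * m)} (hω : IsRationalClass ω₀) (hω0 : ω₀ ≠ 0) :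
    (ratPolarizationForm _ (isRationalClass_ksymm d φ e ha) m
      (lineCoord ω₀ hω0 (Motives.finrank_complexBetti_two_add_two_mul_eq_one (Motives.isSmoothProjective_of_dim_eq' hA)))
      (lineCoord_ratValued _ hω hω0)).Nondegenerate := by
  have hX : IsSmoothProjective (m + 1) A.X := Motives.isSmoothProjective_of_dim_eq' hA
  set h1 := Motives.finrank_complexBetti_two_add_two_mul_eq_one hX with hh1
  set hK := (d : ℂ) • complexBetti.map e.ι 2 a + complexBetti.map φ.hom.hom.hom 2 (complexBetti.map e.ι 2 a)
    with hKdef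
  refine (isRefl_ratPolarizationForm _ _ m _ _).nondegenerate_iff_separatingLeft.2 fun x hx ↦ ?_
  by_contra hx0
  -- `ℓ(Q(x ⊗ 1, c)) = 0` for every `c ∈ H¹(A(ℂ); ℂ)`
  set x' := ofRatClass (ComplexPoints A.X) 1 x with hx'def
  have hline : ∀ c, ∃ r : ℂ, r • ω₀ = c := (finrank_eq_one_iff_of_nonzero' ω₀ hω0).1 h1
  have hzero : ∀ c : complexBetti A.X 1, polarizationPairingOne A.X hK m x' c = 0 := by
    have hrat : ∀ c : complexBetti A.X 1, IsRationalClass c → polarizationPairingOne A.X hK m x' c = 0 := by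
      intro c hc
      obtain ⟨y, rfl⟩ := (isRationalClass_iff_mem_range_ofRatClass c).1 hc
      have h0 := hx y
      have h0' := ratPolarizationForm_spec _ (isRationalClass_ksymm d φ e ha) m (lineCoord ω₀ hω0 h1)
        (lineCoord_ratValued _ hω hω0) x y
      rw [h0, Rat.cast_zero] at h0'
      obtain ⟨r, hr⟩ := hline (polarizationPairingOne A.X hK m x' (ofRatClass (ComplexPoints A.X) 1 y))
      rw [← hr, lineCoord_apply_smul] at h0'
      rw [← hr, ← h0', zero_smul]
    intro c
    have hc : c ∈ Submodule.span ℂ {c : complexBetti A.X 1 | IsRationalClass c} := by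
      rw [span_isRationalClass_eq_top_of_isSmoothProjective_holds (m + 1) A.X hX 1]
      exact Submodule.mem_top
    induction hc using Submodule.span_induction with
    | mem c hc => exact hrat c hc
    | zero => exact map_zero _
    | add c c' _ _ hc hc' => rw [map_add, hc, hc', add_zero]
    | smul r c _ hc => rw [map_smul, hc, smul_zero]
  -- but `Q(x ⊗ 1, C(x ⊗ 1)) = t ω₀' ≠ 0`
  obtain ⟨ω₁, -, hω10, hpos⟩ := exists_pos_polarizationPairingOne_weilOperatorOne hm hA hd φ e ha ha0
  have hx'0 : x' ≠ 0 := fun h0 ↦ hx0 (ofRatClass_injective (Y := ComplexPoints A.X) 1 (by rw [← hx'def, h0, map_zero]))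
  obtain ⟨t, ht, hQ⟩ := hpos x' (conjClass_ofRatClass x) hx'0
  have h := hzero (weilOperatorOne hX x')
  rw [hQ] at h
  exact absurd (smul_eq_zero.1 h) (not_or.2 ⟨by exact_mod_cast ht.ne', hω10⟩)

/-- **The rational Weil datum of `(A, φ, h_K)`** (van Geemen 5.3: "a polarized abelian variety of
Weil-type … provides such data"; Deligne p. 47: `H = H₁(A, ℚ)`, `ψ`): on `V = H¹(A(ℂ); ℚ)`,
`d`, `α = φ^*_ℚ` (`α² = -d`), and the rational Riemann form `E = lineCoord ω₀ ∘ Q_{h_K}` of the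
`K`-symmetrised hyperplane class (`h_K = d·e^*a + φ^*e^*a`), alternating, of Weil type
`E(αx, αy) = d E(x, y)`, non-degenerate (`dim A = m + 1 ≥ 2`). A term of the other seat's
`Motives.WeilDatum`, so that its period-domain and fibre-Hodge-structure theorems apply to actual
abelian varieties of Weil type. [cite: vanGeemen1994HodgeAV, 5.3 with 4.8–4.9 and Lemma 5.2 (2)]
[cite: Deligne1982HodgeCycles, proof of Thm. 4.8, pp. 47–48] -/
def weilDatumOfKsymm (hm : 1 ≤ m) (hA : A.dim = m + 1) (hd : 0 < d) {φ : A ⟶ A}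
    (hφ : φ ≫ φ = -(d • 𝟙 A)) (e : ProjectiveEmbedding A.X) {a : complexBetti (projectiveSpace e.n ℂ) 2}
    (ha : IsRationalClass a) (ha0 : a ≠ 0) {ω₀ : complexBetti A.X (2 + 2 * m)} (hω : IsRationalClass ω₀)
    (hω0 : ω₀ ≠ 0) : Motives.WeilDatum (bettiCohomology A.X 1) where
  d := d
  d_pos := by exact_mod_cast hd
  α := (bettiCohomology.map φ.hom.hom.hom 1).hom
  E := ratPolarizationForm _ (isRationalClass_ksymm d φ e ha) m
      (lineCoord ω₀ hω0 (Motives.finrank_complexBetti_two_add_two_mul_eq_one (Motives.isSmoothProjective_of_dim_eq' hA)))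
      (lineCoord_ratValued _ hω hω0)
  α_α x := bettiMap_bettiMap_of_comp_self hφ x
  E_swap x y := ratPolarizationForm_swap _ _ m _ _ x y
  E_α x y := ratPolarizationForm_map_map_ksymm hA hd hφ e ha _ _ x y
  E_nondegenerate := nondegenerate_ratPolarizationForm_ksymm hm hA hd φ e ha ha0 hω hω0

/-- The `d` of the datum is `d`. [folklore] -/
@[simp]
theorem weilDatumOfKsymm_d (hm : 1 ≤ m) (hA : A.dim = m + 1) (hd : 0 < d) {φ : A ⟶ A}
    (hφ : φ ≫ φ = -(d • 𝟙 A)) (e : ProjectiveEmbedding A.X) {a : complexBetti (projectiveSpace e.n ℂ) 2}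
    (ha : IsRationalClass a) (ha0 : a ≠ 0) {ω₀ : complexBetti A.X (2 + 2 * m)} (hω : IsRationalClass ω₀)
    (hω0 : ω₀ ≠ 0) : (weilDatumOfKsymm hm hA hd hφ e ha ha0 hω hω0).d = d := rfl

/-- The `α` of the datum is `φ^*_ℚ`. [folklore] -/
@[simp]
theorem weilDatumOfKsymm_α_apply (hm : 1 ≤ m) (hA : A.dim = m + 1) (hd : 0 < d) {φ : A ⟶ A}
    (hφ : φ ≫ φ = -(d • 𝟙 A)) (e : ProjectiveEmbedding A.X) {a : complexBetti (projectiveSpace e.n ℂ) 2}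
    (ha : IsRationalClass a) (ha0 : a ≠ 0) {ω₀ : complexBetti A.X (2 + 2 * m)} (hω : IsRationalClass ω₀)
    (hω0 : ω₀ ≠ 0) (x : bettiCohomology A.X 1) :
    (weilDatumOfKsymm hm hA hd hφ e ha ha0 hω hω0).α x = bettiCohomology.map φ.hom.hom.hom 1 x := rfl

/-- The `E` of the datum is the rational Riemann form `lineCoord ω₀ ∘ Q_{h_K}`. [folklore] -/
theorem weilDatumOfKsymm_E (hm : 1 ≤ m) (hA : A.dim = m + 1) (hd : 0 < d) {φ : A ⟶ A}
    (hφ : φ ≫ φ = -(d • 𝟙 A)) (e : ProjectiveEmbedding A.X) {a : complexBetti (projectiveSpace e.n ℂ) 2}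
    (ha : IsRationalClass a) (ha0 : a ≠ 0) {ω₀ : complexBetti A.X (2 + 2 * m)} (hω : IsRationalClass ω₀)
    (hω0 : ω₀ ≠ 0) :
    (weilDatumOfKsymm hm hA hd hφ e ha ha0 hω hω0).E =
      ratPolarizationForm _ (isRationalClass_ksymm d φ e ha) m
        (lineCoord ω₀ hω0 (Motives.finrank_complexBetti_two_add_two_mul_eq_one (Motives.isSmoothProjective_of_dim_eq' hA)))
        (lineCoord_ratValued _ hω hω0) := rfl

/-- **`dim_ℚ H¹(A(ℂ); ℚ) = 2 dim A`** (`b₁ = 2g`; the tree's count of torsion points, Mumford §1 (3)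
with §6 App. 3). [cite: MumfordAV1970, §1 (3)] [cite: LangeBirkenhake1992, Lemma 1.1.17 (a)] -/
theorem finrank_bettiCohomology_one (A : AbelianVariety ℂ) :
    Module.finrank ℚ (bettiCohomology A.X 1) = 2 * A.dim :=
  Motives.AbelianVariety.finrank_bettiCohomology_one_eq_of_natCard_torsionPoints A
    (Motives.AbelianVariety.natCard_torsionPoints_of_isAlgClosed_holds A ℂ)

/-- `H¹(A(ℂ); ℚ)` is finite-dimensional (compact manifold; the tree's
`finite_singularCohomology_rat_complexPoints`). [cite: HatcherAT2002, App. A Cor. A.9 and §3.1 Cor. 3.3] -/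
theorem finite_bettiCohomology_one (A : AbelianVariety ℂ) : Module.Finite ℚ (bettiCohomology A.X 1) :=
  finite_singularCohomology_rat_complexPoints (Motives.AbelianVariety.isSmoothProjective_holds (A := A)) 1

end Datum

/-! ### Hyperbolic ⟹ split: the isotropic `α`-stable `ℚ`-subspace of dimension `2n` -/

section Split

variable {n d : ℕ} {A : AbelianVariety ℂ}

/-- A rational class lying in the complex span of an independent family of rational classes has
RATIONAL coefficients, so it lies in the image of their rational span: the preimage statement used
below. [cite: HatcherAT2002, §3.1 Thm. 3.2 and p. 198] -/
theorem exists_eq_sum_ratCast_smul_of_mem_span {Y : Type} [TopologicalSpace Y] {k : ℕ} {ι : Type*} [Fintype ι]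
    {v : ι → singularCohomology ℂ ℂ Y k} (hv : ∀ i, IsRationalClass (v i)) (hli : LinearIndependent ℂ v)
    {z : singularCohomology ℂ ℂ Y k} (hz : IsRationalClass z) (hzs : z ∈ Submodule.span ℂ (Set.range v)) :
    ∃ q : ι → ℚ, z = ∑ i, ((q i : ℚ) : ℂ) • v i := by
  classical
  obtain ⟨c, rfl⟩ := (Submodule.mem_span_range_iff_exists_fun ℂ).1 hzs
  have hq : ∀ i, ∃ q : ℚ, (q : ℂ) = c i := fun i ↦ by
    obtain ⟨q, hq⟩ := IsRationalClass.coeff_mem_range_of_linearIndependent hv hli hz i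
    exact ⟨q, by rw [← hq]; rfl⟩
  choose q hq using hq
  exact ⟨q, Finset.sum_congr rfl fun i _ ↦ by rw [hq i]⟩

/-- **Hyperbolic ⟹ the rational datum is split** (Deligne–Milne Cor. 4.2 (b): "a totally isotropic
subspace of dimension `d/2`"; van Geemen 5.2: Witt index `n`). If `(A, φ)` is of hyperbolic Weil
type for `h` (`Motives.IsHyperbolicWeilType A φ n h`: a rational, `ℂ`-independent, `φ^*`-stable,
`Q_h`-isotropic `2n`-frame of `H¹(A(ℂ); ℂ)`), then for the rational Riemann form
`E = ℓ ∘ Q_h` (any admissible `ℓ`) there is a `φ^*_ℚ`-stable `ℚ`-subspace `W ⊆ H¹(A(ℂ); ℚ)` of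
dimension `2n` on which `E` vanishes: the rational span of the preimages of the frame (stability
because a rational class in the complex span of independent rational classes has rational
coefficients). [cite: Deligne1982HodgeCycles, §4 Cor. 4.2] [cite: vanGeemen1994HodgeAV, Lemma 5.2 (1)–(2)] -/
theorem exists_isotropic_submodule_of_isHyperbolicWeilType {φ : A ⟶ A} {h : complexBetti A.X 2}
    (hh : IsRationalClass h) {j : ℕ} (ℓ : complexBetti A.X (2 + 2 * j) →ₗ[ℂ] ℂ)
    (hℓ : ∀ c : complexBetti A.X (2 + 2 * j), IsRationalClass c → ∃ q : ℚ, ℓ c = q)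
    (hj : 2 * n - 1 = j) (hhyp : Motives.IsHyperbolicWeilType A φ n h) :
    ∃ W : Submodule ℚ (bettiCohomology A.X 1),
      (∀ x ∈ W, bettiCohomology.map φ.hom.hom.hom 1 x ∈ W) ∧ Module.finrank ℚ W = 2 * n ∧
      ∀ x ∈ W, ∀ y ∈ W, ratPolarizationForm h hh j ℓ hℓ x y = 0 := by
  classical
  subst hj
  obtain ⟨u, hurat, hli, hstab, hiso⟩ := hhyp
  -- rational preimages of the frame
  have hpre : ∀ i, ∃ w : bettiCohomology A.X 1, ofRatClass (ComplexPoints A.X) 1 w = u i :=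
    fun i ↦ (isRationalClass_iff_mem_range_ofRatClass (u i)).1 (hurat i)
  choose w hw using hpre
  refine ⟨Submodule.span ℚ (Set.range w), ?_, ?_, ?_⟩
  · -- stability: enough on generators
    have hgen : ∀ i, bettiCohomology.map φ.hom.hom.hom 1 (w i) ∈ Submodule.span ℚ (Set.range w) := by
      intro i
      have hz : IsRationalClass (complexBetti.map φ.hom.hom.hom 1 (u i)) := (hurat i).pullback _
      obtain ⟨q, hq⟩ := exists_eq_sum_ratCast_smul_of_mem_span hurat hli hz (hstab i)
      have heq : bettiCohomology.map φ.hom.hom.hom 1 (w i) = ∑ l, q l • w l := by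
        apply ofRatClass_injective (Y := ComplexPoints A.X) 1
        rw [ofRatClass_bettiMap, hw, hq, map_sum]
        exact Finset.sum_congr rfl fun l _ ↦ by rw [Motives.ofRatClass_smul, hw]
      rw [heq]
      exact Submodule.sum_mem _ fun l _ ↦ Submodule.smul_mem _ _ (Submodule.subset_span ⟨l, rfl⟩)
    intro x hx
    induction hx using Submodule.span_induction with
    | mem x hx =>
      obtain ⟨i, rfl⟩ := hx
      exact hgen i
    | zero => rw [map_zero]; exact Submodule.zero_mem _
    | add x y _ _ hx hy => rw [map_add]; exact Submodule.add_mem _ hx hy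
    | smul q x _ hx => rw [map_smul]; exact Submodule.smul_mem _ q hx
  · -- dimension: `w` is `ℚ`-independent because `u = w ⊗ 1` is `ℂ`-independent
    have hwli : LinearIndependent ℚ w := by
      rw [← linearIndependent_ringChange_iff]
      have : (fun i ↦ singularCohomology.ringChange (algebraMap ℚ ℂ) (ComplexPoints A.X) 1 (w i)) = u :=
        funext fun i ↦ by rw [← ofRatClass_eq_ringChange, hw]
      rw [this]
      exact hli
    rw [finrank_span_eq_card hwli, Fintype.card_fin]
  · -- isotropy: on generators `E(wᵢ, w_l) ⊗ 1 = ℓ(Q(uᵢ, u_l)) = 0`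
    have hgen : ∀ i l, ratPolarizationForm h hh (2 * n - 1) ℓ hℓ (w i) (w l) = 0 := by
      intro i l
      apply Rat.cast_injective (α := ℂ)
      rw [ratPolarizationForm_spec, hw, hw, hiso i l, map_zero, Rat.cast_zero]
    intro x hx y hy
    exact Motives.bilin_apply_eq_zero_of_mem_span (ratPolarizationForm h hh (2 * n - 1) ℓ hℓ) hgen hx hy

/-- **The hypotheses of the other seat's datum theorems, for an actual hyperbolic abelian
`2n`-fold of Weil type**: `dim_ℚ H¹(A(ℂ); ℚ) = 4n` and a `φ^*`-stable `E`-isotropic `ℚ`-subspace of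
dimension `2n` for the datum `weilDatumOfKsymm` (`E` = the rational Riemann form of `h_K`).
[cite: Deligne1982HodgeCycles, §4 Cor. 4.2 and proof of Thm. 4.8 (p. 48)] [cite: vanGeemen1994HodgeAV, Lemma 5.2 and 5.3] -/
theorem exists_isotropic_submodule_weilDatumOfKsymm {m : ℕ} (hn : 1 ≤ n) (hmn : m + 1 = 2 * n)
    (hA : A.dim = m + 1) (hd : 0 < d) {φ : A ⟶ A} (hφ : φ ≫ φ = -(d • 𝟙 A)) (e : ProjectiveEmbedding A.X)
    {a : complexBetti (projectiveSpace e.n ℂ) 2} (ha : IsRationalClass a) (ha0 : a ≠ 0)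
    {ω₀ : complexBetti A.X (2 + 2 * m)} (hω : IsRationalClass ω₀) (hω0 : ω₀ ≠ 0)
    (hhyp : Motives.IsHyperbolicWeilType A φ n
      ((d : ℂ) • complexBetti.map e.ι 2 a + complexBetti.map φ.hom.hom.hom 2 (complexBetti.map e.ι 2 a))) :
    Module.finrank ℚ (bettiCohomology A.X 1) = 4 * n ∧
    ∃ W : Submodule ℚ (bettiCohomology A.X 1),
      (∀ x ∈ W, (weilDatumOfKsymm (by omega) hA hd hφ e ha ha0 hω hω0).α x ∈ W) ∧
      Module.finrank ℚ W = 2 * n ∧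
      ∀ x ∈ W, ∀ y ∈ W, (weilDatumOfKsymm (by omega) hA hd hφ e ha ha0 hω hω0).E x y = 0 := by
  refine ⟨by rw [finrank_bettiCohomology_one, hA, hmn]; ring, ?_⟩
  exact exists_isotropic_submodule_of_isHyperbolicWeilType (isRationalClass_ksymm d φ e ha)
    (lineCoord ω₀ hω0 _) (lineCoord_ratValued _ hω hω0) (by omega) hhyp

/-- **The period domain of a hyperbolic abelian `2n`-fold of Weil type is the bounded symmetric
domain of `U(n, n)`**: for the rational Weil datum `D` of `(A, φ, h_K)` (hyperbolic, `dim A = 2n`,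
`φ ≫ φ = -d`), the set of `K ⊗ ℝ`-linear complex structures on `(H¹(A(ℂ); ℚ) ⊗ ℝ, i)` positive for
`E` — Deligne's `X⁺` in the spelling `IsWeilComplexStructure D.hForm` — is in bijection with
`unitaryPeriodDomain n n = {Z : ℂⁿ → ℂⁿ, ‖Z‖ < 1} ≅ U(n, n)/U(n) × U(n)` (the other seat's
`WeilDatum.nonempty_weilComplexStructureEquiv_of_isotropic`, fed with
`exists_isotropic_submodule_weilDatumOfKsymm`; van Geemen 5.10, Deligne p. 49 "`X⁺` … open
connected"). [cite: vanGeemen1994HodgeAV, 5.3, 5.5 and 5.10] [cite: Deligne1982HodgeCycles, proof of Thm. 4.8, pp. 48–49] -/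
theorem nonempty_weilComplexStructureEquiv_of_isHyperbolicWeilType {m : ℕ} (hn : 1 ≤ n) (hmn : m + 1 = 2 * n)
    (hA : A.dim = m + 1) (hd : 0 < d) {φ : A ⟶ A} (hφ : φ ≫ φ = -(d • 𝟙 A)) (e : ProjectiveEmbedding A.X)
    {a : complexBetti (projectiveSpace e.n ℂ) 2} (ha : IsRationalClass a) (ha0 : a ≠ 0)
    {ω₀ : complexBetti A.X (2 + 2 * m)} (hω : IsRationalClass ω₀) (hω0 : ω₀ ≠ 0)
    (hhyp : Motives.IsHyperbolicWeilType A φ n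
      ((d : ℂ) • complexBetti.map e.ι 2 a + complexBetti.map φ.hom.hom.hom 2 (complexBetti.map e.ι 2 a))) :
    Nonempty ({J : (weilDatumOfKsymm (by omega) hA hd hφ e ha ha0 hω hω0).Cx →ₗ[ℂ]
        (weilDatumOfKsymm (by omega) hA hd hφ e ha ha0 hω hω0).Cx //
        Motives.IsWeilComplexStructure (weilDatumOfKsymm (by omega) hA hd hφ e ha ha0 hω hω0).hForm J} ≃
      Motives.unitaryPeriodDomain n n) := by
  haveI := finite_bettiCohomology_one A
  obtain ⟨hV, W, hWα, hWn, hiso⟩ := exists_isotropic_submodule_weilDatumOfKsymm hn hmn hA hd hφ e ha ha0 hω hω0 hhyp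
  exact (weilDatumOfKsymm (by omega) hA hd hφ e ha ha0 hω hω0).nonempty_weilComplexStructureEquiv_of_isotropic
    hV hWα hWn hiso

end Split

end HodgeTheory

end Literature.AlgebraicGeometry.HodgeTheory

end
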